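import Summits.QuantumFields.YangMills.Theorems.LuscherReductionOneSiteLevelsKacPotential

/-!
# INNER, flat lane (layer III): Jensen for the heat kernel and the potential transfer

Support module of crux `OneSiteLevels` (route `LuscherReduction`, item stmt-QuantumFields-20007), FLAT lane of the
registered v12 stub `stub_flatKacAL1` (STUB-PLAN rev 3 row III.3, second half).

* Jensen `(P_s r)(x)² ≤ P_s(r²)(x)` for bounded measurable `r` (`∫ p (r − c)² ≥ 0`, `∫ p = 1`);
* `integral_potential_mul_heatSmooth_sq_le`: for bounded measurable integrable `r` with `(1 + ‖x‖⁴) r² ∈ L¹`,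
  `V · (P_s r)²` is integrable and `∫ V (P_s r)² ≤ ∫ (V(x) + 192 s ‖x‖² + 256 s²) r(x)² dx`
  (Jensen, Tonelli for the nonnegative kernel `V(x) p_s(x,y) r(y)²`, symmetry of `p_s`, and `heatSmooth_potential_le`).

Real analysis only ([folklore]); NOT the stub; femto rung R2b1; NOT a claim about the gap.
-/

set_option autoImplicit false

noncomputable section

open MeasureTheory Filter Topology Real
open Literature.Analysis.OperatorTheory.YMMatrixModel

namespace Summit.QuantumFields.YangMills.Theorems.FemtoTransferGap

section Transfer

/-- **Jensen for the heat kernel** (pointwise): `(P_s r)(x)² ≤ P_s(r²)(x)` for bounded measurable `r`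
(`∫ p (r − c)² ≥ 0` with `c = P_s r (x)`, `∫ p = 1`). [folklore] -/
theorem heatSmooth_sq_le {s : ℝ} (hs : 0 < s) {r : ZM → ℝ} (hm : Measurable r) {M : ℝ} (hb : ∀ y, |r y| ≤ M)
    (x : ZM) : heatSmooth s r x ^ 2 ≤ heatSmooth s (fun y => r y ^ 2) x := by
  set c := heatSmooth s r x with hc
  have hM : 0 ≤ M := (abs_nonneg _).trans (hb x)
  have hb2 : ∀ y, |r y ^ 2| ≤ M ^ 2 := fun y => by rw [abs_pow]; exact pow_le_pow_left₀ (abs_nonneg _) (hb y) 2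
  have I0 := integrable_heatKernel_right hs x
  have I1 := integrable_heatKernel_mul hs x hm hb
  have I2 := integrable_heatKernel_mul hs x (hm.pow_const 2) hb2
  have hpos : 0 ≤ ∫ y, heatKernel s x y * (r y - c) ^ 2 :=
    integral_nonneg fun y => mul_nonneg (heatKernel_pos' hs x y).le (sq_nonneg _)
  have e : ∀ y, heatKernel s x y * (r y - c) ^ 2 =
      heatKernel s x y * r y ^ 2 - 2 * c * (heatKernel s x y * r y) + c ^ 2 * heatKernel s x y := fun y => by ring
  simp_rw [e] at hpos
  have IAB : Integrable fun y => heatKernel s x y * r y ^ 2 - 2 * c * (heatKernel s x y * r y) := I2.sub (I1.const_mul _)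
  rw [integral_add IAB (I0.const_mul _), integral_sub I2 (I1.const_mul _), integral_const_mul, integral_const_mul,
    integral_heatKernel_right hs x] at hpos
  have h1 : ∫ y, heatKernel s x y * r y = c := by rw [hc]; rfl
  rw [h1] at hpos
  show c ^ 2 ≤ ∫ y, heatKernel s x y * r y ^ 2
  nlinarith [hpos]

/-- `x ↦ p_s(y,x) V(x)` is integrable and integrates to `(P_s V)(y)`. [folklore] -/
theorem integrable_heatKernel_mul_potential {s : ℝ} (hs : 0 < s) (y : ZM) :
    Integrable fun x => heatKernel s y x * luscherPotential x := by
  have h := integrable_heatKernelUO_mul_potential_shift (half_pos hs) y (-1) (Or.inr rfl)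
  -- `z ↦ G(z) V(y − z)` integrable ⇒ `x ↦ G(y − x) V(x)` integrable (substitute `z = y − x`)
  have h2 : Integrable fun x : ZM => Literature.Analysis.UnboundedOperators.heatKernel (s / 2) (y - x) *
      luscherPotential (y + (-1 : ℝ) • (y - x)) := h.comp_sub_left y
  refine h2.congr (Eventually.of_forall fun x => ?_)
  show Literature.Analysis.UnboundedOperators.heatKernel (s / 2) (y - x) * luscherPotential (y + (-1 : ℝ) • (y - x)) =
    heatKernel s y x * luscherPotential x
  rw [heatKernel_eq_heatKernelUO]
  congr 1
  simp

/-- **The potential transfer** (III.3, sloppy constants): for bounded measurable integrable `r` with `(1 + ‖x‖⁴) r² ∈ L¹`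
and `0 < s`, the function `V · (P_s r)²` is integrable and `∫ V (P_s r)² ≤ ∫ (V(x) + 192 s ‖x‖² + 256 s²) r(x)² dx`
(Jensen + Tonelli for the nonnegative kernel `V(x) p_s(x,y) r(y)²` + the Gaussian smoothing of `V`). [folklore] -/
theorem integral_potential_mul_heatSmooth_sq_le {s : ℝ} (hs : 0 < s) {r : ZM → ℝ} (hm : Measurable r) {M : ℝ}
    (hb : ∀ y, |r y| ≤ M) (hi : Integrable r) (hw : Integrable fun x => (1 + ‖x‖ ^ 4) * r x ^ 2) :
    Integrable (fun x => luscherPotential x * heatSmooth s r x ^ 2) ∧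
      ∫ x, luscherPotential x * heatSmooth s r x ^ 2 ≤
        ∫ x, (luscherPotential x + 192 * s * ‖x‖ ^ 2 + 256 * s ^ 2) * r x ^ 2 := by
  have hM : 0 ≤ M := (abs_nonneg _).trans (hb 0)
  have hb2 : ∀ y, |r y ^ 2| ≤ M ^ 2 := fun y => by rw [abs_pow]; exact pow_le_pow_left₀ (abs_nonneg _) (hb y) 2
  have hm2 : Measurable fun y => r y ^ 2 := hm.pow_const 2
  have hr2 : Integrable fun x => r x ^ 2 := integrable_sq_of_bounded_integrable hm hb hi
  -- the weight `W = V + 192 s ‖x‖² + 256 s²` and `∫ W r² < ∞`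
  set W : ZM → ℝ := fun x => luscherPotential x + 192 * s * ‖x‖ ^ 2 + 256 * s ^ 2 with hW
  have hWc : Continuous W :=
    (continuous_luscherPotential.fun_add (continuous_const.fun_mul (continuous_norm.fun_pow 2))).fun_add continuous_const
  have hW0 : ∀ x, 0 ≤ W x := fun x => by
    have := luscherPotential_nonneg x; simp only [hW]; positivity
  have hWle : ∀ x, W x ≤ (256 * s ^ 2 + 192 * s + 1) * (1 + ‖x‖ ^ 4) := fun x => by
    have hV := luscherPotential_le_norm_pow_four x
    have h2 : ‖x‖ ^ 2 ≤ 1 + ‖x‖ ^ 4 := by nlinarith [sq_nonneg (‖x‖ ^ 2 - 1), pow_nonneg (norm_nonneg x) 2]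
    simp only [hW]
    nlinarith [pow_nonneg (norm_nonneg x) 4, hs.le, sq_nonneg s]
  have hWr : Integrable fun x => W x * r x ^ 2 := by
    refine (hw.const_mul (256 * s ^ 2 + 192 * s + 1)).mono' (hWc.measurable.mul hm2).aestronglyMeasurable
      (Eventually.of_forall fun x => ?_)
    rw [Real.norm_of_nonneg (mul_nonneg (hW0 x) (sq_nonneg _))]
    calc W x * r x ^ 2 ≤ (256 * s ^ 2 + 192 * s + 1) * (1 + ‖x‖ ^ 4) * r x ^ 2 :=
          mul_le_mul_of_nonneg_right (hWle x) (sq_nonneg _)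
      _ = (256 * s ^ 2 + 192 * s + 1) * ((1 + ‖x‖ ^ 4) * r x ^ 2) := by ring
  -- the nonnegative kernel `F(x,y) = V(x) p_s(x,y) r(y)²` on `ZM × ZM`
  set F : ZM × ZM → ℝ := fun q => luscherPotential q.1 * heatKernel s q.1 q.2 * r q.2 ^ 2 with hF
  have hF0 : ∀ q, 0 ≤ F q := fun q =>
    mul_nonneg (mul_nonneg (luscherPotential_nonneg _) (heatKernel_pos' hs _ _).le) (sq_nonneg _)
  have hKc : Continuous fun q : ZM × ZM => heatKernel s q.1 q.2 := by
    have e : (fun q : ZM × ZM => heatKernel s q.1 q.2) =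
        fun q => Literature.Analysis.UnboundedOperators.heatKernel (s / 2) (q.1 - q.2) := by
      funext q; rw [heatKernel_eq_heatKernelUO]
    rw [e]
    exact (Literature.Analysis.UnboundedOperators.continuous_heatKernel _).comp (continuous_fst.sub continuous_snd)
  have hFm : Measurable F :=
    ((continuous_luscherPotential.comp continuous_fst).measurable.mul hKc.measurable).mul (hm2.comp measurable_snd)
  -- inner integrals: in `y` first
  have hIy : ∀ x, ∫⁻ y, ENNReal.ofReal (F (x, y)) =
      ENNReal.ofReal (luscherPotential x * heatSmooth s (fun y => r y ^ 2) x) := by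
    intro x
    have I2 := integrable_heatKernel_mul hs x hm2 hb2
    have e1 : heatSmooth s (fun y => r y ^ 2) x = ∫ y, heatKernel s x y * r y ^ 2 := rfl
    rw [e1, ← integral_const_mul, integral_eq_lintegral_of_nonneg_ae (Eventually.of_forall fun y => ?_)
      ((I2.const_mul _).aestronglyMeasurable)]
    · rw [ENNReal.ofReal_toReal ((I2.const_mul _).lintegral_lt_top).ne]
      refine lintegral_congr fun y => ?_
      simp only [hF]
      rw [mul_assoc]
    · exact mul_nonneg (luscherPotential_nonneg x) (mul_nonneg (heatKernel_pos' hs x y).le (sq_nonneg _))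
  -- inner integrals: in `x` first
  have hIx : ∀ y, ∫⁻ x, ENNReal.ofReal (F (x, y)) =
      ENNReal.ofReal (heatSmooth s luscherPotential y * r y ^ 2) := by
    intro y
    have I3 := integrable_heatKernel_mul_potential hs y
    have e1 : heatSmooth s luscherPotential y * r y ^ 2 = ∫ x, luscherPotential x * heatKernel s x y * r y ^ 2 := by
      unfold heatSmooth
      rw [← integral_mul_const]
      refine integral_congr_ae (Eventually.of_forall fun x => ?_)
      show heatKernel s y x * luscherPotential x * r y ^ 2 = luscherPotential x * heatKernel s x y * r y ^ 2
      rw [heatKernel_symm s y x]; ring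
    have I4 : Integrable fun x => luscherPotential x * heatKernel s x y * r y ^ 2 := by
      refine (I3.mul_const (r y ^ 2)).congr (Eventually.of_forall fun x => ?_)
      show heatKernel s y x * luscherPotential x * r y ^ 2 = luscherPotential x * heatKernel s x y * r y ^ 2
      rw [heatKernel_symm s y x]; ring
    rw [e1, integral_eq_lintegral_of_nonneg_ae (Eventually.of_forall fun x => hF0 (x, y)) I4.aestronglyMeasurable,
      ENNReal.ofReal_toReal I4.lintegral_lt_top.ne]
  -- Tonelli
  have hT : ∫⁻ x, ∫⁻ y, ENNReal.ofReal (F (x, y)) = ∫⁻ y, ∫⁻ x, ENNReal.ofReal (F (x, y)) :=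
    lintegral_lintegral_swap (hFm.ennreal_ofReal.aemeasurable)
  simp_rw [hIy, hIx] at hT
  -- the right side is finite and `≤ ∫ W r²`
  have hPV : ∀ y, heatSmooth s luscherPotential y * r y ^ 2 ≤ W y * r y ^ 2 := fun y =>
    mul_le_mul_of_nonneg_right (heatSmooth_potential_le hs y) (sq_nonneg _)
  have hRfin : ∫⁻ y, ENNReal.ofReal (heatSmooth s luscherPotential y * r y ^ 2) ≤
      ENNReal.ofReal (∫ y, W y * r y ^ 2) := by
    rw [MeasureTheory.ofReal_integral_eq_lintegral_ofReal hWr (Eventually.of_forall fun y => mul_nonneg (hW0 y) (sq_nonneg _))]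
    exact lintegral_mono fun y => ENNReal.ofReal_le_ofReal (hPV y)
  -- integrability of `V · P_s(r²)` and of the smaller `V · (P_s r)²`
  have hcont2 : Continuous (heatSmooth s fun y => r y ^ 2) := continuous_heatSmooth hs hr2
  have hcont1 : Continuous (heatSmooth s r) := continuous_heatSmooth hs hi
  have hVP2m : AEStronglyMeasurable (fun x => luscherPotential x * heatSmooth s (fun y => r y ^ 2) x) volume :=
    (continuous_luscherPotential.fun_mul hcont2).aestronglyMeasurable
  have hVP2fin : ∫⁻ x, ENNReal.ofReal (luscherPotential x * heatSmooth s (fun y => r y ^ 2) x) < ⊤ := by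
    rw [hT]; exact lt_of_le_of_lt hRfin ENNReal.ofReal_lt_top
  have hVP2nn : ∀ x, 0 ≤ luscherPotential x * heatSmooth s (fun y => r y ^ 2) x := fun x =>
    mul_nonneg (luscherPotential_nonneg x) (integral_nonneg fun y => mul_nonneg (heatKernel_pos' hs x y).le (sq_nonneg _))
  have hVP2 : Integrable fun x => luscherPotential x * heatSmooth s (fun y => r y ^ 2) x := by
    refine ⟨hVP2m, ?_⟩
    rw [hasFiniteIntegral_iff_ofReal (Eventually.of_forall hVP2nn)]
    exact hVP2fin
  have hJ : ∀ x, luscherPotential x * heatSmooth s r x ^ 2 ≤ luscherPotential x * heatSmooth s (fun y => r y ^ 2) x :=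
    fun x => mul_le_mul_of_nonneg_left (heatSmooth_sq_le hs hm hb x) (luscherPotential_nonneg x)
  have hVP1 : Integrable fun x => luscherPotential x * heatSmooth s r x ^ 2 := by
    refine hVP2.mono' (continuous_luscherPotential.fun_mul (hcont1.fun_pow 2)).aestronglyMeasurable
      (Eventually.of_forall fun x => ?_)
    rw [Real.norm_of_nonneg (mul_nonneg (luscherPotential_nonneg x) (sq_nonneg _))]
    exact hJ x
  refine ⟨hVP1, ?_⟩
  -- the chain of inequalities
  have h1 : ∫ x, luscherPotential x * heatSmooth s r x ^ 2 ≤ ∫ x, luscherPotential x * heatSmooth s (fun y => r y ^ 2) x :=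
    integral_mono hVP1 hVP2 hJ
  have h2 : ∫ x, luscherPotential x * heatSmooth s (fun y => r y ^ 2) x ≤ ∫ y, W y * r y ^ 2 := by
    have e := integral_eq_lintegral_of_nonneg_ae (Eventually.of_forall hVP2nn) hVP2m
    rw [e, hT]
    have hfin : ∫⁻ y, ENNReal.ofReal (heatSmooth s luscherPotential y * r y ^ 2) ≠ ⊤ :=
      (lt_of_le_of_lt hRfin ENNReal.ofReal_lt_top).ne
    have h0 : 0 ≤ ∫ y, W y * r y ^ 2 := integral_nonneg fun y => mul_nonneg (hW0 y) (sq_nonneg _)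
    exact (ENNReal.toReal_le_toReal hfin ENNReal.ofReal_ne_top).2 hRfin |>.trans (by rw [ENNReal.toReal_ofReal h0])
  exact h1.trans h2

end Transfer

end Summit.QuantumFields.YangMills.Theorems.FemtoTransferGap

end
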